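import Summits.Parity.BatemanHorn.Theorems.SoloBlindParityImpostor
import Mathlib.NumberTheory.ArithmeticFunction.VonMangoldt
import Mathlib.NumberTheory.ArithmeticFunction.Moebius
import HarnessLib

/-!
# The one-line parity impostor below level `1/2` and the even-reflection duality — PROVED

Solo seat `solo-Parity-blind` (summit `Parity`, conjunct `BatemanHorn`), paper §8.2 and §8.5.

**The impostor.**  For a finite set `P` of primes (think `P = {p : x^γ < p ≤ x^{γ+η}}`, `γ < 1/2`,
`2γ + η < 1`) let `g P n := #{p ∈ P : p ∣ n}` (imported from `SoloBlindParityImpostor`) and `κ := ∑_{p ∈ P} 1/p`.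
The sequence `a(n) := κ⁻¹ g P n` on `(x/2, x]` is nonnegative, bounded, VANISHES AT EVERY PRIME, and this file
proves its class statistics EXACTLY, for every modulus `d` coprime to the members of `P`, on any interval
`(a, b]`:

* plain (`g_class_sum`, `g_class_sum_error`):
  `∑_{a<n≤b, d∣n} g P n = ∑_{p∈P} (⌊b/(pd)⌋ − ⌊a/(pd)⌋)`, hence
  `|∑_{a<n≤b, d∣n} g P n − ((b−a)/d)·∑_{p∈P} 1/p| ≤ #P` — NO analytic input at all: Type I for `a` holds
  with error `κ⁻¹ #P` per modulus (`simpleImpostor_class_sum_error`), i.e. level `min(γ, 1−γ−η)`;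
* twisted by Liouville `λ = (−1)^Ω` (`g_class_sum_twisted`, `g_class_sum_twisted_abs_le`):
  `∑_{a<n≤b, d∣n} λ(n) g P n = −λ(d) ∑_{p∈P} ∑_{a/(pd) < k ≤ b/(pd)} λ(k)`, hence
  `|∑ λ·g| ≤ ∑_{p} |∑_{k ∈ (a/(pd), b/(pd)]} λ(k)|` — the ONLY analytic input needed for Type I of `λ·a` is
  cancellation in plain Liouville sums over intervals of length `≍ x^{1−2γ−η}` (prime number theorem).

So Type I information of any level `γ < 1/2` for BOTH `a` and `λa` (Ford–Maynard axioms plus Hooley's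
“no parity bias in progressions’’) is consistent with the total absence of primes.

**Duality.**  `dual a (n) := 2 − a(n)` if `Ω n` is even, `a(n)` otherwise.  It is an involution on sequences
with values in `[0,2]`, fixes the values at primes, and SWAPS the plain and the `λ`-twisted class statistics
(`dual_sub_one`, `lam_mul_dual`, `dual_class_sum`, `dual_class_sum_twisted`): an impostor with plain level `ν`
and twisted level `α` becomes one with plain level `α` and twisted level `ν`.
Elementary; no `sorry`, standard axioms.
-/

noncomputable section

open Finset
open ArithmeticFunction
open scoped ArithmeticFunction.Omega

namespace Summit.Parity.BatemanHorn.Theorems.SoloBlindSimpleImpostor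

open Summit.Parity.BatemanHorn.Theorems.SoloBlindParityImpostor (g g_eq_zero_of_prime)

variable {P : Finset ℕ} {a b d q n p : ℕ} {κ : ℝ}

/-- Liouville's function as a real number: `λ n = (−1)^{Ω n}`. -/
def lam (n : ℕ) : ℝ := (-1 : ℝ) ^ (Ω n)

/-- `|λ n| = 1`. -/
theorem abs_lam : |lam n| = 1 := by
  unfold lam
  rw [abs_pow, abs_neg, abs_one, one_pow]

/-- `λ` at a prime is `−1`. -/
theorem lam_prime (hp : p.Prime) : lam p = -1 := by
  unfold lam
  rw [cardFactors_apply_prime hp, pow_one]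

/-- Complete multiplicativity of `λ` (away from `0`). -/
theorem lam_mul (hm : q ≠ 0) (hn : n ≠ 0) : lam (q * n) = lam q * lam n := by
  unfold lam
  rw [cardFactors_mul hm hn, pow_add]

/-! ## Counting and re-indexing multiples of `q` in an interval `(a, b]` -/

/-- `n ∈ (a,b]` with `q ∣ n` iff `n = qk` with `k ∈ (a/q, b/q]` (natural-number division). -/
theorem mem_filter_dvd_Ioc_iff (hq : 0 < q) :
    n ∈ (Ioc a b).filter (q ∣ ·) ↔ ∃ k ∈ Ioc (a / q) (b / q), q * k = n := by
  constructor
  · intro h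
    rw [mem_filter, mem_Ioc] at h
    obtain ⟨⟨ha, hb⟩, k, rfl⟩ := h
    refine ⟨k, ?_, rfl⟩
    rw [mem_Ioc]
    constructor
    · rw [Nat.div_lt_iff_lt_mul hq, mul_comm]
      exact ha
    · rw [Nat.le_div_iff_mul_le hq, mul_comm]
      exact hb
  · rintro ⟨k, hk, rfl⟩
    rw [mem_Ioc] at hk
    rw [mem_filter, mem_Ioc]
    refine ⟨⟨?_, ?_⟩, dvd_mul_right q k⟩
    · have h := (Nat.div_lt_iff_lt_mul hq).mp hk.1
      rw [mul_comm] at h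
      exact h
    · have h := (Nat.le_div_iff_mul_le hq).mp hk.2
      rw [mul_comm] at h
      exact h

/-- The multiples of `q` in `(a,b]` are the image of `(a/q, b/q]` under `k ↦ qk`. -/
theorem filter_dvd_Ioc_eq_image (hq : 0 < q) :
    (Ioc a b).filter (q ∣ ·) = (Ioc (a / q) (b / q)).image (q * ·) := by
  ext n
  rw [mem_image]
  exact mem_filter_dvd_Ioc_iff hq

/-- Re-indexing a sum over the multiples of `q` in `(a,b]` by the cofactor. -/
theorem sum_filter_dvd_Ioc (hq : 0 < q) (f : ℕ → ℝ) :
    ∑ n ∈ (Ioc a b).filter (q ∣ ·), f n = ∑ k ∈ Ioc (a / q) (b / q), f (q * k) := by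
  rw [filter_dvd_Ioc_eq_image hq, Finset.sum_image]
  intro x _ y _ h
  exact Nat.eq_of_mul_eq_mul_left hq h

/-- The number of multiples of `q` in `(a,b]` is `⌊b/q⌋ − ⌊a/q⌋`. -/
theorem card_filter_dvd_Ioc (hq : 0 < q) : #((Ioc a b).filter (q ∣ ·)) = b / q - a / q := by
  rw [filter_dvd_Ioc_eq_image hq, card_image_of_injective, Nat.card_Ioc]
  intro x y h
  exact Nat.eq_of_mul_eq_mul_left hq h

/-- `⌊b/q⌋ − ⌊a/q⌋` is within `1` of `(b − a)/q` (for `a ≤ b`). -/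
theorem floor_count_error (hq : 0 < q) (hab : a ≤ b) :
    |((b / q - a / q : ℕ) : ℝ) - ((b : ℝ) - a) / q| ≤ 1 := by
  have hq' : (0 : ℝ) < q := by exact_mod_cast hq
  have hle : a / q ≤ b / q := Nat.div_le_div_right hab
  rw [Nat.cast_sub hle]
  have hu1 : ((b / q : ℕ) : ℝ) ≤ (b : ℝ) / q := Nat.cast_div_le
  have hv1 : ((a / q : ℕ) : ℝ) ≤ (a : ℝ) / q := Nat.cast_div_le
  have hu2 : (b : ℝ) / q - 1 < ((b / q : ℕ) : ℝ) := by
    have h := Nat.lt_div_mul_add (a := b) hq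
    have h' : (b : ℝ) < ((b / q : ℕ) : ℝ) * q + q := by exact_mod_cast h
    rw [sub_lt_iff_lt_add, div_lt_iff₀ hq']
    linarith
  have hv2 : (a : ℝ) / q - 1 < ((a / q : ℕ) : ℝ) := by
    have h := Nat.lt_div_mul_add (a := a) hq
    have h' : (a : ℝ) < ((a / q : ℕ) : ℝ) * q + q := by exact_mod_cast h
    rw [sub_lt_iff_lt_add, div_lt_iff₀ hq']
    linarith
  rw [abs_le]
  constructor
  · rw [sub_div]; linarith
  · rw [sub_div]; linarith

/-! ## Plain class sums of `g` -/

/-- `g` as a sum of indicators. -/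
theorem g_eq_sum_ite (P : Finset ℕ) (n : ℕ) :
    (g P n : ℝ) = ∑ p ∈ P, if p ∣ n then (1 : ℝ) else 0 := by
  unfold g
  rw [Finset.card_filter]
  push_cast
  rfl

/-- For `d` and `p` coprime, `d ∣ n ∧ p ∣ n ↔ pd ∣ n`, at the level of filters of `(a,b]`. -/
theorem filter_dvd_and_dvd (hcop : Nat.Coprime p d) :
    ((Ioc a b).filter (d ∣ ·)).filter (p ∣ ·) = (Ioc a b).filter (p * d ∣ ·) := by
  rw [Finset.filter_filter]
  refine Finset.filter_congr fun n _ => ?_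
  constructor
  · rintro ⟨h1, h2⟩
    exact hcop.mul_dvd_of_dvd_of_dvd h2 h1
  · intro h
    exact ⟨(dvd_mul_left d p).trans h, (dvd_mul_right p d).trans h⟩

/-- EXACT PLAIN CLASS SUM: `∑_{a<n≤b, d∣n} g P n = ∑_{p∈P} (⌊b/(pd)⌋ − ⌊a/(pd)⌋)` for `d` coprime to the
(positive) members of `P`. -/
theorem g_class_sum (hd : 0 < d) (hP : ∀ p ∈ P, 0 < p ∧ Nat.Coprime p d) :
    ∑ n ∈ (Ioc a b).filter (d ∣ ·), (g P n : ℝ)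
      = ∑ p ∈ P, ((b / (p * d) - a / (p * d) : ℕ) : ℝ) := by
  simp_rw [g_eq_sum_ite]
  rw [Finset.sum_comm]
  refine Finset.sum_congr rfl fun p hp => ?_
  obtain ⟨hp0, hcop⟩ := hP p hp
  rw [Finset.sum_boole, filter_dvd_and_dvd hcop, card_filter_dvd_Ioc (Nat.mul_pos hp0 hd)]

/-- PLAIN TYPE I WITHOUT ANALYSIS: `|∑_{a<n≤b, d∣n} g P n − ((b−a)/d)·∑_{p∈P} 1/p| ≤ #P`. -/
theorem g_class_sum_error (hd : 0 < d) (hab : a ≤ b) (hP : ∀ p ∈ P, 0 < p ∧ Nat.Coprime p d) :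
    |∑ n ∈ (Ioc a b).filter (d ∣ ·), (g P n : ℝ) - (((b : ℝ) - a) / d) * ∑ p ∈ P, (1 / (p : ℝ))|
      ≤ #P := by
  rw [g_class_sum hd hP, Finset.mul_sum, ← Finset.sum_sub_distrib]
  have hcard : ((#P : ℕ) : ℝ) = ∑ p ∈ P, (1 : ℝ) := by simp
  rw [hcard]
  refine (Finset.abs_sum_le_sum_abs _ _).trans (Finset.sum_le_sum fun p hp => ?_)
  obtain ⟨hp0, _⟩ := hP p hp
  have hpd : 0 < p * d := Nat.mul_pos hp0 hd
  have h := floor_count_error (a := a) (b := b) hpd hab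
  have heq : ((b : ℝ) - a) / d * (1 / (p : ℝ)) = ((b : ℝ) - a) / ((p * d : ℕ) : ℝ) := by
    have hp' : (p : ℝ) ≠ 0 := by exact_mod_cast hp0.ne'
    have hd' : (d : ℝ) ≠ 0 := by exact_mod_cast hd.ne'
    push_cast
    field_simp
  rw [heq]
  exact h

/-! ## `λ`-twisted class sums of `g` -/

/-- EXACT TWISTED CLASS SUM: for primes `p ∈ P` coprime to `d`,
`∑_{a<n≤b, d∣n} λ(n) g P n = −λ(d) · ∑_{p∈P} ∑_{a/(pd) < k ≤ b/(pd)} λ(k)`. -/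
theorem g_class_sum_twisted (hd : 0 < d) (hP : ∀ p ∈ P, p.Prime ∧ Nat.Coprime p d) :
    ∑ n ∈ (Ioc a b).filter (d ∣ ·), lam n * (g P n : ℝ)
      = - lam d * ∑ p ∈ P, ∑ k ∈ Ioc (a / (p * d)) (b / (p * d)), lam k := by
  simp_rw [g_eq_sum_ite, Finset.mul_sum]
  rw [Finset.sum_comm]
  refine Finset.sum_congr rfl fun p hp => ?_
  obtain ⟨hpP, hcop⟩ := hP p hp
  have hpd : 0 < p * d := Nat.mul_pos hpP.pos hd
  have h1 : ∑ n ∈ (Ioc a b).filter (d ∣ ·), lam n * (if p ∣ n then (1 : ℝ) else 0)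
      = ∑ n ∈ ((Ioc a b).filter (d ∣ ·)).filter (p ∣ ·), lam n := by
    rw [Finset.sum_filter (p := (p ∣ ·)) (s := (Ioc a b).filter (d ∣ ·))]
    refine Finset.sum_congr rfl fun n _ => ?_
    split_ifs <;> simp
  rw [h1, filter_dvd_and_dvd hcop, sum_filter_dvd_Ioc hpd]
  refine Finset.sum_congr rfl fun k hk => ?_
  rw [mem_Ioc] at hk
  have hk0 : k ≠ 0 := by
    intro h
    rw [h] at hk
    exact Nat.not_lt_zero _ hk.1
  rw [lam_mul hpd.ne' hk0, lam_mul hpP.ne_zero hd.ne', lam_prime hpP]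
  ring

/-- TWISTED TYPE I REDUCES TO LIOUVILLE SUMS OVER INTERVALS:
`|∑_{a<n≤b, d∣n} λ(n) g P n| ≤ ∑_{p∈P} |∑_{a/(pd) < k ≤ b/(pd)} λ(k)|`. -/
theorem g_class_sum_twisted_abs_le (hd : 0 < d) (hP : ∀ p ∈ P, p.Prime ∧ Nat.Coprime p d) :
    |∑ n ∈ (Ioc a b).filter (d ∣ ·), lam n * (g P n : ℝ)|
      ≤ ∑ p ∈ P, |∑ k ∈ Ioc (a / (p * d)) (b / (p * d)), lam k| := by
  rw [g_class_sum_twisted hd hP, abs_mul, abs_neg, abs_lam, one_mul]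
  exact Finset.abs_sum_le_sum_abs _ _

/-! ## The normalised impostor `κ⁻¹ g` -/

/-- The one-line impostor `a(n) = κ⁻¹ · #{p ∈ P : p ∣ n}`. -/
def simpleImpostor (P : Finset ℕ) (κ : ℝ) (n : ℕ) : ℝ := κ⁻¹ * (g P n : ℝ)

/-- The impostor is nonnegative. -/
theorem simpleImpostor_nonneg (hκ : 0 ≤ κ) : 0 ≤ simpleImpostor P κ n := by
  unfold simpleImpostor
  have : 0 ≤ κ⁻¹ := inv_nonneg.mpr hκ
  positivity

/-- The impostor is bounded by `κ⁻¹ #P`. -/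
theorem simpleImpostor_le (hκ : 0 ≤ κ) : simpleImpostor P κ n ≤ κ⁻¹ * #P := by
  unfold simpleImpostor
  have hκ' : 0 ≤ κ⁻¹ := inv_nonneg.mpr hκ
  have hg : (g P n : ℝ) ≤ #P := by
    unfold g
    exact_mod_cast Finset.card_filter_le _ _
  exact mul_le_mul_of_nonneg_left hg hκ'

/-- THE IMPOSTOR CONTAINS NO PRIMES: `a(q) = 0` for every prime `q ∉ P` (with `1 ∉ P`). -/
theorem simpleImpostor_prime (hp : p.Prime) (hP : ∀ q ∈ P, q ≠ 1 ∧ q ≠ p) :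
    simpleImpostor P κ p = 0 := by
  simp [simpleImpostor, g_eq_zero_of_prime hp hP]

/-- PLAIN TYPE I FOR THE IMPOSTOR, each modulus, no analysis: with `κ = ∑_{p∈P} 1/p`,
`|∑_{a<n≤b, d∣n} a(n) − (b−a)/d| ≤ κ⁻¹ #P`. -/
theorem simpleImpostor_class_sum_error (hd : 0 < d) (hab : a ≤ b) (hκ : 0 < κ)
    (hκP : κ = ∑ p ∈ P, (1 / (p : ℝ))) (hP : ∀ p ∈ P, 0 < p ∧ Nat.Coprime p d) :
    |∑ n ∈ (Ioc a b).filter (d ∣ ·), simpleImpostor P κ n - ((b : ℝ) - a) / d| ≤ κ⁻¹ * #P := by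
  unfold simpleImpostor
  rw [← Finset.mul_sum]
  have hκ0 : κ ≠ 0 := hκ.ne'
  have hmain : ((b : ℝ) - a) / d = κ⁻¹ * ((((b : ℝ) - a) / d) * ∑ p ∈ P, (1 / (p : ℝ))) := by
    rw [← hκP]
    field_simp
  rw [hmain, ← mul_sub, abs_mul, abs_of_pos (inv_pos.mpr hκ)]
  exact mul_le_mul_of_nonneg_left (g_class_sum_error hd hab hP) (inv_nonneg.mpr hκ.le)

/-- TWISTED TYPE I FOR THE IMPOSTOR reduces to Liouville sums over intervals:
`|∑_{a<n≤b, d∣n} λ(n) a(n)| ≤ κ⁻¹ ∑_{p∈P} |∑_{a/(pd)<k≤b/(pd)} λ(k)|`. -/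
theorem simpleImpostor_class_sum_twisted_abs_le (hd : 0 < d) (hκ : 0 ≤ κ)
    (hP : ∀ p ∈ P, p.Prime ∧ Nat.Coprime p d) :
    |∑ n ∈ (Ioc a b).filter (d ∣ ·), lam n * simpleImpostor P κ n|
      ≤ κ⁻¹ * ∑ p ∈ P, |∑ k ∈ Ioc (a / (p * d)) (b / (p * d)), lam k| := by
  unfold simpleImpostor
  have h : ∑ n ∈ (Ioc a b).filter (d ∣ ·), lam n * (κ⁻¹ * (g P n : ℝ))
      = κ⁻¹ * ∑ n ∈ (Ioc a b).filter (d ∣ ·), lam n * (g P n : ℝ) := by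
    rw [Finset.mul_sum]
    refine Finset.sum_congr rfl fun n _ => ?_
    ring
  rw [h, abs_mul, abs_of_nonneg (inv_nonneg.mpr hκ)]
  exact mul_le_mul_of_nonneg_left (g_class_sum_twisted_abs_le hd hP) (inv_nonneg.mpr hκ)

/-! ## Even-reflection duality -/

/-- `dual a`: reflect the values at even-`Ω` integers about `1`, keep the values at odd-`Ω` integers. -/
def dual (f : ℕ → ℝ) (n : ℕ) : ℝ := if Even (Ω n) then 2 - f n else f n

/-- `dual` is an involution. -/
theorem dual_dual (f : ℕ → ℝ) : dual (dual f) = f := by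
  funext n
  unfold dual
  split_ifs <;> ring

/-- `dual` does not change the value at a prime (primes have odd `Ω`); in particular it preserves
prime-freeness. -/
theorem dual_prime (f : ℕ → ℝ) (hp : p.Prime) : dual f p = f p := by
  have hodd : ¬ Even (Ω p) := by
    rw [cardFactors_apply_prime hp]
    exact Nat.not_even_one
  simp [dual, hodd]

/-- `dual` preserves the value range `[0, 2]`. -/
theorem dual_mem_Icc (f : ℕ → ℝ) (h0 : 0 ≤ f n) (h2 : f n ≤ 2) :
    0 ≤ dual f n ∧ dual f n ≤ 2 := by
  unfold dual
  split_ifs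
  · constructor <;> linarith
  · exact ⟨h0, h2⟩

/-- Pointwise: `dual f − 1 = −λ · (f − 1)`. -/
theorem dual_sub_one (f : ℕ → ℝ) (n : ℕ) : dual f n - 1 = - lam n * (f n - 1) := by
  unfold dual lam
  by_cases h : Even (Ω n)
  · rw [if_pos h, Even.neg_one_pow h]
    ring
  · rw [if_neg h, Odd.neg_one_pow (Nat.not_even_iff_odd.mp h)]
    ring

/-- Pointwise: `λ · dual f = λ − (f − 1)`. -/
theorem lam_mul_dual (f : ℕ → ℝ) (n : ℕ) : lam n * dual f n = lam n - (f n - 1) := by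
  have hsq : lam n * lam n = 1 := by
    unfold lam
    rw [← pow_add, ← two_mul, pow_mul]
    norm_num
  have h := dual_sub_one f n
  have : dual f n = 1 - lam n * (f n - 1) := by linarith
  rw [this, mul_sub, mul_one, ← mul_assoc, hsq, one_mul]

/-- DUALITY, PLAIN SIDE: on any finite set `S` (e.g. a divisor class), the plain discrepancy of `dual f`
is minus the `λ`-twisted discrepancy of `f`:  `∑_{S} (dual f − 1) = −∑_{S} λ·(f − 1)`. -/
theorem dual_class_sum (f : ℕ → ℝ) (S : Finset ℕ) :
    ∑ n ∈ S, (dual f n - 1) = - ∑ n ∈ S, lam n * (f n - 1) := by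
  rw [← Finset.sum_neg_distrib]
  refine Finset.sum_congr rfl fun n _ => ?_
  rw [dual_sub_one]
  ring

/-- DUALITY, TWISTED SIDE: the `λ`-twisted sum of `dual f` is the `λ`-sum minus the plain discrepancy of
`f`:  `∑_{S} λ · dual f = ∑_{S} λ − ∑_{S} (f − 1)`.  Hence `dual` swaps the plain and twisted Type I
levels of a sequence with values in `[0,2]` (the bare `∑_S λ` is `o(#S)` on long progressions). -/
theorem dual_class_sum_twisted (f : ℕ → ℝ) (S : Finset ℕ) :
    ∑ n ∈ S, lam n * dual f n = ∑ n ∈ S, lam n - ∑ n ∈ S, (f n - 1) := by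
  rw [← Finset.sum_sub_distrib]
  refine Finset.sum_congr rfl fun n _ => ?_
  exact lam_mul_dual f n

end Summit.Parity.BatemanHorn.Theorems.SoloBlindSimpleImpostor

end
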